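import Literature.AnabelianGeometry.EtaleTheta.ThetaKummerClass

/-!
# [EtTh] Prop. 1.4 (iii): the predicate "`η̈^Θ` is an étale theta class of the Kummer class of `Θ̈`"

Mochizuki, *The étale theta function …*, Publ. RIMS **45** (2009), pp. 20–22: `η̈^Θ` is CONSTRUCTED
from `Θ̈` ("the Kummer class of the theta function"), and "by abuse of the definite article, we shall
refer to any element of the set `O^×_K̈ · η̈^Θ` as the étale theta class" (p. 21)
[cite: MochizukiEtTh2009, Prop 1.4 (iii) p.22]. In `EtaleThetaClass.lean` (abc-iut-L2-t1) `etaDd` is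
abstract DATA; L2-lead ruling 2026-08-25 20:58:14Z / amended 21:02:24Z (hazard noted by abc-iut-L6-t23:
the RAW Kummer class of `Θ̈` need not be of standard type, so the relation is ORBIT MEMBERSHIP, not
equality): record the intended relation as a PREDICATE on the pair (data `E`, geometric input `T` of
`ThetaKummerClass.lean`), and derive Prop. 1.4 (iii)₁ from it. Nothing of t1's files is touched;
nothing printed is asserted unconditionally (abc-iut-L2-t12).

* `EtaleThetaData.IsThetaKummer E T` — `η̈^Θ ∈ O^×_K̈ · κΘ̈`: the datum `etaDd` is SOME unit translate
  of the Kummer class `T.kummerTheta` of `Θ̈`;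
* `isThetaKummer_iff_mem` / `isThetaKummer_iff_thetaClasses_eq` / `isThetaKummer_iff_prop14iiiKummer`
  — equivalent forms: `κΘ̈` is a theta class; the theta classes ARE the orbit `O^×_K̈ · κΘ̈`; t1's
  `Prop14iiiKummer E κΘ̈`;
* `prop14iii_of_isThetaKummer` — the ruling's item (i): `IsThetaKummer → Prop14iiiKummer E κΘ̈`;
* `thetaClasses_eq_kummerUnitMultiples_of_isThetaKummer` — with `ConstCompat`, the theta classes are
  then literally the Kummer classes of the `O^×_K̈`-multiples `c · Θ̈` (printed sentence, p. 22).

Item (ii) of the ruling (the §1 model satisfies `IsThetaKummer`) is abc-iut-L2-t8's adapter.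
-/

noncomputable section

namespace Literature.AnabelianGeometry.EtaleTheta

open Literature.AnabelianGeometry.SemiGraphs

namespace ThetaSetting

variable {p : ℕ} [Fact p.Prime] {D : ThetaSetting p}

/-- **`η̈^Θ` is an étale theta class of the Kummer class of `Θ̈`**: the datum `etaDd` of `E` lies in the
`O^×_K̈`-orbit of the Kummer class `κΘ̈ = T.kummerTheta` ("any element of the set `O^×_K̈ · η̈^Θ`",
p. 21; orbit membership, not equality: the raw Kummer class of `Θ̈` need not be the standard
representative). [cite: MochizukiEtTh2009, Prop 1.4 (iii) p.22] -/
def EtaleThetaData.IsThetaKummer (E : D.EtaleThetaData) (T : D.ThetaKummerInput) : Prop :=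
  ∃ k ∈ E.kumUnitsYdd, E.etaDd = k * T.kummerTheta

variable (E : D.EtaleThetaData) (T : D.ThetaKummerInput)

/-- `IsThetaKummer` iff `κΘ̈` is one of the theta classes `O^×_K̈ · η̈^Θ`.
[cite: MochizukiEtTh2009, Prop 1.4 (iii) p.22] -/
theorem isThetaKummer_iff_mem : E.IsThetaKummer T ↔ T.kummerTheta ∈ E.thetaClasses := by
  constructor
  · rintro ⟨k, hk, hη⟩
    exact ⟨k⁻¹, inv_mem hk, by rw [hη, inv_mul_cancel_left]⟩
  · rintro ⟨k, hk, hκ⟩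
    exact ⟨k⁻¹, inv_mem hk, by rw [hκ, inv_mul_cancel_left]⟩

/-- `IsThetaKummer` iff the set of theta classes IS the orbit `O^×_K̈ · κΘ̈`.
[cite: MochizukiEtTh2009, Prop 1.4 (iii) p.22] -/
theorem isThetaKummer_iff_thetaClasses_eq :
    E.IsThetaKummer T ↔ E.thetaClasses = {x | ∃ k ∈ E.kumUnitsYdd, x = k * T.kummerTheta} :=
  (isThetaKummer_iff_mem E T).trans (prop14iiiKummer_iff E _).symm

/-- `IsThetaKummer` iff t1's predicate `Prop14iiiKummer E κΘ̈` holds.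
[cite: MochizukiEtTh2009, Prop 1.4 (iii) p.22] -/
theorem isThetaKummer_iff_prop14iiiKummer : E.IsThetaKummer T ↔ Prop14iiiKummer E T.kummerTheta :=
  isThetaKummer_iff_thetaClasses_eq E T

variable {E T}

/-- **Ruling item (i)**: if `η̈^Θ` is an étale theta class of `κΘ̈`, then Prop. 1.4 (iii), first
sentence, holds as typed for the REAL Kummer class `κΘ̈` of `Θ̈`. [cite: MochizukiEtTh2009, Prop 1.4 (iii) p.22] -/
theorem prop14iii_of_isThetaKummer (h : E.IsThetaKummer T) : Prop14iiiKummer E T.kummerTheta :=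
  T.prop14iiiKummer_of_etaDd_mem E h

/-- And, granted the compatibility of the two Kummer maps of constants (`ConstCompat`), the theta
classes are exactly the Kummer classes of the `O^×_K̈`-multiples `c · Θ̈` — the printed sentence
"the classes `O^×_K̈ · η̈^Θ` … are precisely the Kummer classes associated to `O^×_K̈`-multiples of
`Θ̈`" (p. 22). [cite: MochizukiEtTh2009, Prop 1.4 (iii) p.22] -/
theorem thetaClasses_eq_kummerUnitMultiples_of_isThetaKummer (h : E.IsThetaKummer T)
    (hT : T.ConstCompat E.toKummerData) :
    E.thetaClasses = {x | ∃ c ∈ D.unitsOKdd, x = T.kummerConstMulTheta c} :=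
  T.thetaClasses_eq_kummerUnitMultiples E hT h

end ThetaSetting

end Literature.AnabelianGeometry.EtaleTheta

end
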